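import Summits.NavierStokesRegularity.NavierStokesRegularity.Theorems.StrainDoorsTypeITangentHessian
import Summits.NavierStokesRegularity.NavierStokesRegularity.Theorems.StrainDoorsPeakDoors
import HarnessLib

/-!
# StrainDoorsTypeITangentTwist — PART M §M4: THE NEAR-RECORD EXTRACTION WITH HESSIANS (the twist converges)

nsreg-p1 g36, ROUND-62 (helper lane of `stmt-NavierStokesRegularity-0056`, rung N0; 0 ledger writes by the
planner — text for the S-lane to land `--supports stmt-NavierStokesRegularity-0056 --as helper`; tree file 1 of 2
of ROUND-62, §M5 (the laws on `u` itself) is `StrainDoorsTypeITangentTwistLaws`, which imports this file; bodies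
farm-certified inside `r62/StrainDoorsR62All.lean`, rc 0 · 0 warn · 0 sorry, 9/9 std axioms).

PART L (ROUND 60) transported the STRETCHING rate `(0 − t)⟪ξ, ∇u ξ⟫` from the extracted Type-I tangent peak back
to the near-record points of `u`; PART M §M1–§M3 (ROUND 61) supplied second-order tangent convergence and the
scale law of the twist.  This file does the same for Constantin's geometric-depletion quantity, the TWIST `|∇ξ|²_F`
of the vorticity direction `ξ = ω/|ω|` read at ONE point at the parabolic scale, `(0 − t)|∇ξ|²_F`:

* `tendsto_vorticityDirection_fderiv_formula_apply`, `tendsto_frobeniusNormSq_of_tendsto_apply`,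
  ★ `tendsto_frobeniusNormSq_fderiv_vorticityDirection` — the twist density is continuous along `C¹`-convergent
  vorticities at a non-zero limit (VECTOR-level continuity of the direction-gradient formula
  `Φ(a,B) = B/|a| − (⟪a,B·⟫/|a|³) ⊗ a` of `hasFDerivAt_vorticityDirection`; no operator-norm topology is touched —
  the operator-level statement hits a `whnf` heartbeat wall when the CLM-space topologies are unified);
* ★★ `typeI_nearRecord_extraction₂` — the near-record extraction of PART L WITH HESSIANS: from points of classical
  Type-I solutions (one constant `C₀`) whose scale-invariant vorticity comes within `δ_j → 0` of an upper bound
  `W_j ≥ w₀ > 0` of the vorticity number, one extracts a member `(v, z̄)` of the Type-I tangent peak class with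
  `ρ̄ ≥ w₀` and ONE subsequence along which BOTH `(0 − t)⟪ξ, ∇u ξ⟫ → (0 − (−1))⟪ξ̄, ∇v(−1,z̄) ξ̄⟫` AND
  `(0 − t)|∇ξ|²_F → (0 − (−1))|∇ξ̄|²_F(z̄)` (§M2 Hessian extraction, §M1 equi-Lipschitz Hessians at moving points,
  §M3 scale law, the continuity lemma; `ω ≠ 0` at the points since `W_j − δ_j ≥ w₀/2`).

WHAT THIS IS NOT: a compactness/transfer lemma; nothing here excludes a blow-up; `0056` / `10661` / NS regularity
are NOT proved; the peak doors of PART K stay OPEN.  No new definitions; no sorry.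
[cite: ConstantinFefferman1993, §1; KochNadirashviliSereginSverak2009, §2 p. 5, (4.11), Lemma 6.1;
ChaeWolf2017RemovingDSS, §3 Step 2]
-/

noncomputable section

open MeasureTheory Set Function Filter Metric Real InnerProductSpace
open _root_.Topology
open scoped ENNReal NNReal RealInnerProductSpace ContDiff Laplacian
open Literature.Analysis Literature.Analysis.FluidPDE
open Literature.Analysis.FluidPDE.VorticityDirectionDynamics

set_option linter.dupNamespace false

namespace Summit.NavierStokesRegularity.NavierStokesRegularity.Theorems.StrainDoors

open Summit.NavierStokesRegularity.NavierStokesRegularity.Theorems.ArgmaxDoors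

/-! ## §M4 The near-record extraction with Hessians: the twist converges -/

/-- **Continuity of the direction-gradient formula (vector level).**  With
`Φ(a,B) = B/|a| − (⟪a, B·⟫/|a|³) ⊗ a` — the Fréchet derivative of `ω ↦ ω/|ω|` at a point with `ω = a ≠ 0`, `Dω = B`
(tree `hasFDerivAt_vorticityDirection`) — `a_j → ā ≠ 0` and `B_j e → B̄ e` give `Φ(a_j,B_j) e → Φ(ā,B̄) e`
(limit algebra of the three factors; no operator-norm topology is touched). [folklore] -/
theorem tendsto_vorticityDirection_fderiv_formula_apply {a : ℕ → EuclideanSpace ℝ (Fin 3)}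
    {abar : EuclideanSpace ℝ (Fin 3)}
    {B : ℕ → (EuclideanSpace ℝ (Fin 3)) →L[ℝ] (EuclideanSpace ℝ (Fin 3))}
    {Bbar : (EuclideanSpace ℝ (Fin 3)) →L[ℝ] (EuclideanSpace ℝ (Fin 3))}
    (ha : Tendsto a atTop (𝓝 abar)) (hne : abar ≠ 0) (e : EuclideanSpace ℝ (Fin 3))
    (hB : Tendsto (fun j => B j e) atTop (𝓝 (Bbar e))) :
    Tendsto (fun j => (‖a j‖⁻¹ • B j + ((-(‖a j‖ ^ 3)⁻¹) • (innerSL ℝ (a j)).comp (B j)).smulRight (a j) :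
      (EuclideanSpace ℝ (Fin 3)) →L[ℝ] (EuclideanSpace ℝ (Fin 3))) e)
      atTop (𝓝 ((‖abar‖⁻¹ • Bbar + ((-(‖abar‖ ^ 3)⁻¹) • (innerSL ℝ abar).comp Bbar).smulRight abar :
      (EuclideanSpace ℝ (Fin 3)) →L[ℝ] (EuclideanSpace ℝ (Fin 3))) e)) := by
  have hρ : ‖abar‖ ≠ 0 := norm_ne_zero_iff.mpr hne
  have key : ∀ (a' : EuclideanSpace ℝ (Fin 3))
      (B' : (EuclideanSpace ℝ (Fin 3)) →L[ℝ] (EuclideanSpace ℝ (Fin 3))),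
      ((‖a'‖⁻¹ • B' + ((-(‖a'‖ ^ 3)⁻¹) • (innerSL ℝ a').comp B').smulRight a' :
        (EuclideanSpace ℝ (Fin 3)) →L[ℝ] (EuclideanSpace ℝ (Fin 3))) e) =
      ‖a'‖⁻¹ • B' e + ((-(‖a'‖ ^ 3)⁻¹) * ⟪a', B' e⟫) • a' := fun _ _ => rfl
  simp only [key]
  exact ((ha.norm.inv₀ hρ).smul hB).add
    (((((ha.norm.pow 3).inv₀ (pow_ne_zero 3 hρ)).neg).mul (ha.inner hB)).smul ha)

/-- The Frobenius norm is continuous along linear maps converging on the standard basis. [folklore] -/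
theorem tendsto_frobeniusNormSq_of_tendsto_apply
    {L : ℕ → (EuclideanSpace ℝ (Fin 3)) →L[ℝ] (EuclideanSpace ℝ (Fin 3))}
    {Lbar : (EuclideanSpace ℝ (Fin 3)) →L[ℝ] (EuclideanSpace ℝ (Fin 3))}
    (hL : ∀ i, Tendsto (fun j => L j (stdOrthonormalBasis ℝ (EuclideanSpace ℝ (Fin 3)) i)) atTop
      (𝓝 (Lbar (stdOrthonormalBasis ℝ (EuclideanSpace ℝ (Fin 3)) i)))) :
    Tendsto (fun j => frobeniusNormSq (L j)) atTop (𝓝 (frobeniusNormSq Lbar)) := by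
  unfold frobeniusNormSq
  exact tendsto_finsetSum _ fun i _ => ((hL i).norm).pow 2

/-- ★ **THE TWIST DENSITY IS CONTINUOUS ALONG `C¹`-CONVERGENT VORTICITIES AT A NON-ZERO LIMIT.**  If
`ω_j(z_j) → ω̄(z̄) ≠ 0`, `ω_j(z_j) ≠ 0`, and the derivatives `Dω_j(z_j) → Dω̄(z̄)` on the standard basis, then
`|∇ξ_j|²_F(z_j) → |∇ξ̄|²_F(z̄)` for the direction fields `ξ_j = ω_j/|ω_j|`, `ξ̄ = ω̄/|ω̄|`. [folklore] -/
theorem tendsto_frobeniusNormSq_fderiv_vorticityDirection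
    {w : ℕ → (EuclideanSpace ℝ (Fin 3)) → (EuclideanSpace ℝ (Fin 3))}
    {wbar : (EuclideanSpace ℝ (Fin 3)) → (EuclideanSpace ℝ (Fin 3))}
    {B : ℕ → (EuclideanSpace ℝ (Fin 3)) →L[ℝ] (EuclideanSpace ℝ (Fin 3))}
    {Bbar : (EuclideanSpace ℝ (Fin 3)) →L[ℝ] (EuclideanSpace ℝ (Fin 3))}
    {z : ℕ → EuclideanSpace ℝ (Fin 3)} {zbar : EuclideanSpace ℝ (Fin 3)}
    (hw : ∀ j, HasFDerivAt (w j) (B j) (z j)) (hwbar : HasFDerivAt wbar Bbar zbar)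
    (hnej : ∀ j, w j (z j) ≠ 0) (hne : wbar zbar ≠ 0)
    (ha : Tendsto (fun j => w j (z j)) atTop (𝓝 (wbar zbar)))
    (hB : ∀ i, Tendsto (fun j => B j (stdOrthonormalBasis ℝ (EuclideanSpace ℝ (Fin 3)) i)) atTop
      (𝓝 (Bbar (stdOrthonormalBasis ℝ (EuclideanSpace ℝ (Fin 3)) i)))) :
    Tendsto (fun j => frobeniusNormSq (fderiv ℝ (vorticityDirection (w j)) (z j))) atTop
      (𝓝 (frobeniusNormSq (fderiv ℝ (vorticityDirection wbar) zbar))) := by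
  rw [(hasFDerivAt_vorticityDirection hwbar hne).fderiv]
  refine (tendsto_frobeniusNormSq_of_tendsto_apply fun i =>
    tendsto_vorticityDirection_fderiv_formula_apply ha hne _ (hB i)).congr fun j => ?_
  rw [(hasFDerivAt_vorticityDirection (hw j) (hnej j)).fderiv]

/-- ★★ **NEAR-RECORD EXTRACTION WITH HESSIANS: THE TWIST CONVERGES TOO.**  In the situation of
`typeI_nearRecord_extraction` (classical Type-I solutions `(u_j,p_j)` with one constant `C₀`, vorticity numbers
dominated by `W_j ≥ w₀ > 0`, points `(t_j,x_j)` with `(0 − t_j)|ω_j(t_j,x_j)| ≥ W_j − δ_j`, `0 ≤ δ_j ≤ w₀/2`,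
`δ_j → 0`) there are a member `(v, z̄)` of the Type-I tangent peak class with `ρ̄ ≥ w₀` and ONE subsequence `θ` along
which BOTH scale-invariant quantities converge to their values at the peak: the stretching rates
`(0 − t)⟪ξ, ∇u ξ⟫ → (0 − (−1))⟪ξ̄, ∇v(−1,z̄) ξ̄⟫` AND the twists `(0 − t)|∇ξ|²_F → (0 − (−1))|∇ξ̄|²_F(z̄)`.
(§L2 + the Hessian extraction §M2 + equi-Lipschitz Hessians §M1 at moving points + the scale law §M3 + the
continuity of the direction-gradient formula above; `ω ≠ 0` at the points because `W_j − δ_j ≥ w₀/2 > 0`.)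
[new-as-typed] -/
theorem typeI_nearRecord_extraction₂ {C₀ w₀ : ℝ} (hw₀ : 0 < w₀)
    {u : ℕ → ℝ → (EuclideanSpace ℝ (Fin 3)) → (EuclideanSpace ℝ (Fin 3))}
    {p : ℕ → ℝ → (EuclideanSpace ℝ (Fin 3)) → ℝ} {W t δ : ℕ → ℝ} {x : ℕ → EuclideanSpace ℝ (Fin 3)}
    (hsol : ∀ j, IsClassicalNSSolutionOn (Iio 0) 1 0 (u j) (p j)) (hI : ∀ j, HasTypeIDecay C₀ (u j))
    (hdom : ∀ j, ∀ s : ℝ, s < 0 → ∀ y, (0 - s) * ‖curl (u j s) y‖ ≤ W j) (hW : ∀ j, w₀ ≤ W j)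
    (ht : ∀ j, t j < 0) (hnear : ∀ j, W j - δ j ≤ (0 - t j) * ‖curl (u j (t j)) (x j)‖)
    (hδ1 : ∀ j, δ j ≤ w₀ / 2) (hδ : Tendsto δ atTop (𝓝 0)) :
    ∃ (v : ℝ → (EuclideanSpace ℝ (Fin 3)) → (EuclideanSpace ℝ (Fin 3))) (zbar : EuclideanSpace ℝ (Fin 3)),
      IsTypeITangentPeak C₀ v zbar ∧ w₀ ≤ ‖curl (v (-1)) zbar‖ ∧
      ∃ θ : ℕ → ℕ, StrictMono θ ∧
        Tendsto (fun j => (0 - t (θ j)) * ⟪vorticityDirection (curl (u (θ j) (t (θ j)))) (x (θ j)),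
            fderiv ℝ (u (θ j) (t (θ j))) (x (θ j)) (vorticityDirection (curl (u (θ j) (t (θ j)))) (x (θ j)))⟫)
          atTop (𝓝 ((0 - (-1)) * ⟪vorticityDirection (curl (v (-1))) zbar,
            fderiv ℝ (v (-1)) zbar (vorticityDirection (curl (v (-1))) zbar)⟫)) ∧
        Tendsto (fun j => (0 - t (θ j)) *
            frobeniusNormSq (fderiv ℝ (vorticityDirection (curl (u (θ j) (t (θ j))))) (x (θ j))))
          atTop (𝓝 ((0 - (-1)) * frobeniusNormSq (fderiv ℝ (vorticityDirection (curl (v (-1)))) zbar))) := by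
  have hC₀ : 0 ≤ C₀ := HasTypeIDecay.nonneg' (hI 0)
  -- rescale every point to time `-1` (as in §L2)
  obtain ⟨lam, hlam⟩ : ∃ lam : ℕ → ℝ, lam = fun j => √(0 - t j) := ⟨_, rfl⟩
  have hlam0 : ∀ j, 0 < lam j := fun j => by rw [hlam]; exact Real.sqrt_pos.mpr (by linarith [ht j])
  have hlam2 : ∀ j, lam j ^ 2 = 0 - t j := fun j => by rw [hlam]; exact Real.sq_sqrt (by linarith [ht j])
  obtain ⟨u', hu'⟩ : ∃ u' : ℕ → ℝ → (EuclideanSpace ℝ (Fin 3)) → (EuclideanSpace ℝ (Fin 3)),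
      u' = fun j => nsRescale (lam j) (u j) := ⟨_, rfl⟩
  obtain ⟨z, hz⟩ : ∃ z : ℕ → EuclideanSpace ℝ (Fin 3), z = fun j => (lam j)⁻¹ • x j := ⟨_, rfl⟩
  have hcl : ∀ j, IsClassicalNSSolutionOn (Iio 0) 1 0 (u' j) (nsRescalePressure (lam j) (p j)) := fun j => by
    rw [hu']; exact (typeI_class_nsRescale (hlam0 j) (hsol j) (hI j)).1
  have hIj : ∀ j, HasTypeIDecay C₀ (u' j) := fun j => by
    rw [hu']; exact (typeI_class_nsRescale (hlam0 j) (hsol j) (hI j)).2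
  have hxz : ∀ j, lam j • z j = x j := fun j => by rw [hz]; exact smul_inv_smul₀ (hlam0 j).ne' _
  have ht1 : ∀ j, lam j ^ 2 * (-1) = t j := fun j => by rw [hlam2]; ring
  have hnum : ∀ j, ∀ s : ℝ, s < 0 → ∀ y, (0 - s) * ‖curl (u' j s) y‖ ≤ W j := fun j s hs y => by
    rw [hu']; dsimp only
    rw [vorticityNumber_nsRescale]
    have hs' : lam j ^ 2 * s < 0 := mul_neg_of_pos_of_neg (pow_pos (hlam0 j) 2) hs
    exact hdom j _ hs' _
  have hcurl' : ∀ j, curl (u' j (-1)) (z j) = (0 - t j) • curl (u j (t j)) (x j) := fun j => by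
    rw [hu']; dsimp only
    rw [curl_eq_curlCLM, curl_eq_curlCLM, fderiv_nsRescale, map_smul, ht1, hxz, hlam2]
  have hfd' : ∀ j, fderiv ℝ (u' j (-1)) (z j) = (0 - t j) • fderiv ℝ (u j (t j)) (x j) := fun j => by
    rw [hu']; dsimp only
    rw [fderiv_nsRescale, ht1, hxz, hlam2]
  have hnorm' : ∀ j, ‖curl (u' j (-1)) (z j)‖ = (0 - t j) * ‖curl (u j (t j)) (x j)‖ := fun j => by
    rw [hcurl', norm_smul, Real.norm_of_nonneg (by linarith [ht j])]
  have hnear' : ∀ j, W j - δ j ≤ ‖curl (u' j (-1)) (z j)‖ := fun j => by rw [hnorm']; exact hnear j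
  have hξ' : ∀ j, vorticityDirection (curl (u' j (-1))) (z j) = vorticityDirection (curl (u j (t j))) (x j) := by
    intro j
    have h0 : (0 - t j) ≠ 0 := by linarith [ht j]
    rw [vorticityDirection_apply, vorticityDirection_apply, hcurl', norm_smul,
      Real.norm_of_nonneg (by linarith [ht j]), mul_inv, smul_smul, mul_right_comm, inv_mul_cancel₀ h0,
      one_mul]
  have hαeq : ∀ j, (0 - (-1)) * ⟪vorticityDirection (curl (u' j (-1))) (z j),
      fderiv ℝ (u' j (-1)) (z j) (vorticityDirection (curl (u' j (-1))) (z j))⟫ =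
      (0 - t j) * ⟪vorticityDirection (curl (u j (t j))) (x j),
        fderiv ℝ (u j (t j)) (x j) (vorticityDirection (curl (u j (t j))) (x j))⟫ := fun j => by
    rw [hξ', hfd']
    rw [show ((0 - t j) • fderiv ℝ (u j (t j)) (x j)) (vorticityDirection (curl (u j (t j))) (x j)) =
      (0 - t j) • fderiv ℝ (u j (t j)) (x j) (vorticityDirection (curl (u j (t j))) (x j)) from rfl,
      inner_smul_right]
    ring
  -- the vorticity does not vanish at the points, and the twist is scale free (§M3)
  have hpos : ∀ j, 0 < W j - δ j := fun j => by have := hδ1 j; have := hW j; linarith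
  have hwne : ∀ j, curl (u j (t j)) (x j) ≠ 0 := fun j h0 => by
    have h := hnear j
    rw [h0, norm_zero, mul_zero] at h
    linarith [hpos j]
  have hne' : ∀ j, curl (u' j (-1)) (z j) ≠ 0 := fun j => by
    rw [← norm_pos_iff]; linarith [hnear' j, hpos j]
  have hD1 : ∀ j, Differentiable ℝ (fderiv ℝ (u j (t j))) := fun j =>
    (((hsol j).contDiff_velocity (mem_Iio.mpr (ht j))).fderiv_right (m := 1) (by norm_cast)).differentiable
      (by norm_cast)
  have hdξ : ∀ j, DifferentiableAt ℝ (vorticityDirection (curl (u j (t j)))) (x j) := fun j => by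
    have hdc : Differentiable ℝ (curl (u j (t j))) := by
      rw [curl_eq_curlCLM_comp]; exact curlCLM.differentiable.comp (hD1 j)
    exact (hasFDerivAt_vorticityDirection (hdc (x j)).hasFDerivAt (hwne j)).differentiableAt
  have hFeq : ∀ j, (0 - (-1)) * frobeniusNormSq (fderiv ℝ (vorticityDirection (curl (u' j (-1)))) (z j)) =
      (0 - t j) * frobeniusNormSq (fderiv ℝ (vorticityDirection (curl (u j (t j)))) (x j)) := fun j => by
    have hd : DifferentiableAt ℝ (vorticityDirection (curl (u j (lam j ^ 2 * (-1))))) (lam j • z j) := by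
      rw [ht1, hxz]; exact hdξ j
    rw [hu']; dsimp only
    rw [twist_nsRescale (hlam0 j) (u j) (-1) (z j) hd, ht1, hxz, hlam2]
    ring
  -- the rescaled points stay in a ball (near-records live in a parabolic cone, PART G)
  obtain ⟨R, hR, hcone⟩ := typeI_vorticity_nearRecord_cone hC₀ (w₀ / 2) (by positivity)
  have hzR : ∀ j, ‖z j‖ < R := fun j => by
    have hη : w₀ / 2 ≤ (0 - (-1)) * ‖curl (u' j (-1)) (z j)‖ := by
      have h1 := hnear' j; have h2 := hδ1 j; have h3 := hW j
      norm_num; linarith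
    have h := hcone (hcl j) (hIj j) (-1) (by norm_num) (z j) hη
    norm_num at h
    exact h
  obtain ⟨B, hB, hBb⟩ := typeI_vorticityNumber_bound hC₀
  have hWle : ∀ j, W j ≤ B + w₀ := fun j => by
    have h1 := hnear' j
    have h2 := hBb (hcl j) (hIj j) (-1) (by norm_num) (z j)
    have h3 : δ j ≤ w₀ := (hδ1 j).trans (by linarith)
    norm_num at h2
    linarith
  -- tangent field with gradients (PART H), then Hessians along a further subsequence (§M2)
  obtain ⟨φ, hφ, v, hvc, hlimv, hdiff, hlimD, hcurlmv, hvI, hweak, -⟩ := typeI_tangent_field hC₀ hcl hIj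
  have h14 : (-1 : ℝ) ≤ -(1 / 4 : ℝ) := by norm_num
  obtain ⟨ψH, hψH, hHv, hHmv⟩ :=
    typeI_tangent_hessian hC₀ (fun n => hcl (φ n)) (fun n => hIj (φ n)) (v := v) h14 (hlimD (-1) h14)
  have hψH' : Tendsto ψH atTop atTop := hψH.tendsto_atTop
  -- Bolzano–Weierstrass on the pairs (centre, number)
  have hmem : ∀ n, ((z (φ (ψH n)), W (φ (ψH n))) : EuclideanSpace ℝ (Fin 3) × ℝ) ∈
      Metric.closedBall (0 : EuclideanSpace ℝ (Fin 3) × ℝ) (max R (B + w₀)) := fun n => by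
    rw [mem_closedBall_zero_iff, Prod.norm_def]
    refine max_le_max (hzR _).le ?_
    rw [Real.norm_of_nonneg (by linarith [hW (φ (ψH n))])]
    exact hWle _
  obtain ⟨q, -, ψ, hψ, hq⟩ := tendsto_subseq_of_bounded (Metric.isBounded_closedBall) hmem
  have hψ' : Tendsto ψ atTop atTop := hψ.tendsto_atTop
  have hzlim : Tendsto (fun j => z (φ (ψH (ψ j)))) atTop (𝓝 q.1) := (continuous_fst.tendsto q).comp hq
  have hWlim : Tendsto (fun j => W (φ (ψH (ψ j)))) atTop (𝓝 q.2) := (continuous_snd.tendsto q).comp hq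
  obtain ⟨zbar, hzbar⟩ : ∃ zbar : EuclideanSpace ℝ (Fin 3), zbar = q.1 := ⟨_, rfl⟩
  obtain ⟨Wbar, hWbar⟩ : ∃ Wbar : ℝ, Wbar = q.2 := ⟨_, rfl⟩
  rw [← hzbar] at hzlim
  rw [← hWbar] at hWlim
  have hWbar0 : w₀ ≤ Wbar := ge_of_tendsto' hWlim fun j => hW _
  -- uniform spatial Lipschitz bounds for vorticities, gradients and Hessians at `t = -1` (PART H, §M1)
  obtain ⟨K₂, L₁, hK₂, hL₁, hG⟩ := exists_uniform_gradLipschitz hC₀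
  have hgl : ∀ j, LipschitzWith (Real.toNNReal (‖curlCLM‖ * K₂))
      (fun y => curl (u' (φ (ψH (ψ j))) (-1)) y) := fun j =>
    LipschitzWith.of_dist_le_mul fun a b => by
      rw [dist_eq_norm, dist_eq_norm, Real.coe_toNNReal _ (by positivity)]
      exact curl_sub_le_of_fderiv_lipschitz ((hG (hcl _) (hIj _)).1 (-1) h14) a b
  have hgl' : ∀ j, LipschitzWith (Real.toNNReal K₂) (fun y => fderiv ℝ (u' (φ (ψH (ψ j))) (-1)) y) :=
    fun j => LipschitzWith.of_dist_le_mul fun a b => by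
      rw [dist_eq_norm, dist_eq_norm, Real.coe_toNNReal _ hK₂]
      exact (hG (hcl _) (hIj _)).1 (-1) h14 a b
  obtain ⟨K₂', K₃', hK₂', hK₃', hH⟩ := exists_uniform_hessLipschitz hC₀
  have hHl : ∀ j, LipschitzWith (Real.toNNReal K₃')
      (fun y => fderiv ℝ (fderiv ℝ (u' (φ (ψH (ψ j))) (-1))) y) := fun j =>
    LipschitzWith.of_dist_le_mul fun a b => by
      rw [dist_eq_norm, dist_eq_norm, Real.coe_toNNReal K₃' hK₃']
      exact (hH (hcl _) (hIj _)).2 (-1) h14 a b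
  -- moving-point convergence of vorticity, gradient and Hessian at the rescaled points
  have hconvω : Tendsto (fun j => curl (u' (φ (ψH (ψ j))) (-1)) (z (φ (ψH (ψ j))))) atTop
      (𝓝 (curl (v (-1)) zbar)) :=
    ChaeWolf.tendsto_apply_of_tendsto hgl hzlim
      (((hcurlmv (-1) h14 (fun _ => zbar) zbar tendsto_const_nhds).comp hψH').comp hψ')
  have hconvA : Tendsto (fun j => fderiv ℝ (u' (φ (ψH (ψ j))) (-1)) (z (φ (ψH (ψ j))))) atTop
      (𝓝 (fderiv ℝ (v (-1)) zbar)) :=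
    ChaeWolf.tendsto_apply_of_tendsto hgl' hzlim (((hlimD (-1) h14 zbar).comp hψH').comp hψ')
  have hconvH : Tendsto (fun j => fderiv ℝ (fderiv ℝ (u' (φ (ψH (ψ j))) (-1))) (z (φ (ψH (ψ j))))) atTop
      (𝓝 (fderiv ℝ (fderiv ℝ (v (-1))) zbar)) :=
    ChaeWolf.tendsto_apply_of_tendsto hHl hzlim ((hHmv (fun _ => zbar) zbar tendsto_const_nhds).comp hψ')
  -- the limit point is an attained record of `v`: `‖ω_v(-1, zbar)‖ = Wbar`
  have hup : ∀ j, ‖curl (u' (φ (ψH (ψ j))) (-1)) (z (φ (ψH (ψ j))))‖ ≤ W (φ (ψH (ψ j))) := fun j => by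
    have h := hnum (φ (ψH (ψ j))) (-1) (by norm_num) (z (φ (ψH (ψ j))))
    norm_num at h
    exact h
  have hlow : Tendsto (fun j => W (φ (ψH (ψ j))) - δ (φ (ψH (ψ j)))) atTop (𝓝 Wbar) := by
    have h0 : Tendsto (fun j => δ (φ (ψH (ψ j)))) atTop (𝓝 0) :=
      hδ.comp ((hφ.comp (hψH.comp hψ)).tendsto_atTop)
    simpa using hWlim.sub h0
  have hatt : ‖curl (v (-1)) zbar‖ = Wbar :=
    tendsto_nhds_unique hconvω.norm
      (tendsto_of_tendsto_of_tendsto_of_le_of_le hlow hWlim (fun j => hnear' _) hup)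
  have hne : curl (v (-1)) zbar ≠ 0 := by
    rw [← norm_pos_iff, hatt]; linarith
  -- `v` is dominated by `Wbar` on `s ≤ -1/4`
  have hnumv : ∀ s ≤ -(1 / 4 : ℝ), ∀ y, (0 - s) * ‖curl (v s) y‖ ≤ (0 - (-1)) * ‖curl (v (-1)) zbar‖ := by
    intro s hs y
    have hs0 : s < 0 := by linarith
    have hlim := ((((hcurlmv s hs (fun _ => y) y tendsto_const_nhds).comp hψH').comp hψ').norm.const_mul
      (0 - s))
    have h := le_of_tendsto_of_tendsto' hlim hWlim fun j => hnum (φ (ψH (ψ j))) s hs0 y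
    rw [hatt]; linarith
  have hP : IsTypeITangentPeak C₀ v zbar := ⟨hvc, hvI, hweak, hne, hnumv⟩
  have hρ : 0 < ‖curl (v (-1)) zbar‖ := norm_pos_iff.mpr hne
  -- the stretching rates at the rescaled points converge to the stretching rate at the record
  have hconvξ : Tendsto (fun j => vorticityDirection (curl (u' (φ (ψH (ψ j))) (-1))) (z (φ (ψH (ψ j)))))
      atTop (𝓝 (vorticityDirection (curl (v (-1))) zbar)) := by
    simp only [vorticityDirection_apply]
    exact (hconvω.norm.inv₀ hρ.ne').smul hconvω
  have happly : Continuous fun w : ((EuclideanSpace ℝ (Fin 3)) →L[ℝ] (EuclideanSpace ℝ (Fin 3))) ×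
      (EuclideanSpace ℝ (Fin 3)) => w.1 w.2 := isBoundedBilinearMap_apply.continuous
  have hconvAξ : Tendsto (fun j => fderiv ℝ (u' (φ (ψH (ψ j))) (-1)) (z (φ (ψH (ψ j))))
      (vorticityDirection (curl (u' (φ (ψH (ψ j))) (-1))) (z (φ (ψH (ψ j)))))) atTop
      (𝓝 (fderiv ℝ (v (-1)) zbar (vorticityDirection (curl (v (-1))) zbar))) :=
    (happly.tendsto (fderiv ℝ (v (-1)) zbar, vorticityDirection (curl (v (-1))) zbar)).comp
      (hconvA.prodMk_nhds hconvξ)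
  have hconvα : Tendsto (fun j => (0 - (-1)) *
      ⟪vorticityDirection (curl (u' (φ (ψH (ψ j))) (-1))) (z (φ (ψH (ψ j)))),
      fderiv ℝ (u' (φ (ψH (ψ j))) (-1)) (z (φ (ψH (ψ j))))
        (vorticityDirection (curl (u' (φ (ψH (ψ j))) (-1))) (z (φ (ψH (ψ j)))))⟫) atTop
      (𝓝 ((0 - (-1)) * ⟪vorticityDirection (curl (v (-1))) zbar,
        fderiv ℝ (v (-1)) zbar (vorticityDirection (curl (v (-1))) zbar)⟫)) :=
    (hconvξ.inner hconvAξ).const_mul _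
  -- the twists at the rescaled points converge to the twist at the record
  have happly2 : Continuous fun w : ((EuclideanSpace ℝ (Fin 3)) →L[ℝ]
      ((EuclideanSpace ℝ (Fin 3)) →L[ℝ] (EuclideanSpace ℝ (Fin 3)))) × (EuclideanSpace ℝ (Fin 3)) => w.1 w.2 :=
    isBoundedBilinearMap_apply.continuous
  have hconvB : ∀ e : EuclideanSpace ℝ (Fin 3),
      Tendsto (fun j => (curlCLM.comp (fderiv ℝ (fderiv ℝ (u' (φ (ψH (ψ j))) (-1))) (z (φ (ψH (ψ j)))))) e)
        atTop (𝓝 ((curlCLM.comp (fderiv ℝ (fderiv ℝ (v (-1))) zbar)) e)) := fun e =>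
    (curlCLM.continuous.tendsto _).comp
      ((happly2.tendsto (fderiv ℝ (fderiv ℝ (v (-1))) zbar, e)).comp (hconvH.prodMk_nhds tendsto_const_nhds))
  have hHj : ∀ j y, HasFDerivAt (fderiv ℝ (u' j (-1))) (fderiv ℝ (fderiv ℝ (u' j (-1))) y) y := fun j y =>
    (((((hcl j).contDiff_velocity (show (-1 : ℝ) ∈ Iio 0 by norm_num)).fderiv_right (m := 1)
      (by norm_cast)).differentiable (by norm_cast)) y).hasFDerivAt
  have hconvF : Tendsto (fun j => frobeniusNormSq
      (fderiv ℝ (vorticityDirection (curl (u' (φ (ψH (ψ j))) (-1)))) (z (φ (ψH (ψ j)))))) atTop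
      (𝓝 (frobeniusNormSq (fderiv ℝ (vorticityDirection (curl (v (-1)))) zbar))) :=
    tendsto_frobeniusNormSq_fderiv_vorticityDirection
      (w := fun j => curl (u' (φ (ψH (ψ j))) (-1))) (z := fun j => z (φ (ψH (ψ j))))
      (fun j => hasFDerivAt_curl_of_hasFDerivAt_fderiv (hHj _ _))
      (hasFDerivAt_curl_of_hasFDerivAt_fderiv (hHv zbar)) (fun j => hne' _) hne hconvω
      fun i => hconvB _
  have hconvT : Tendsto (fun j => (0 - t (φ (ψH (ψ j)))) * frobeniusNormSq
      (fderiv ℝ (vorticityDirection (curl (u (φ (ψH (ψ j))) (t (φ (ψH (ψ j))))))) (x (φ (ψH (ψ j)))))) atTop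
      (𝓝 ((0 - (-1)) * frobeniusNormSq (fderiv ℝ (vorticityDirection (curl (v (-1)))) zbar))) :=
    (hconvF.const_mul (0 - (-1))).congr fun j => hFeq (φ (ψH (ψ j)))
  refine ⟨v, zbar, hP, hatt ▸ hWbar0, fun j => φ (ψH (ψ j)), hφ.comp (hψH.comp hψ), ?_, hconvT⟩
  exact hconvα.congr fun j => hαeq (φ (ψH (ψ j)))

end Summit.NavierStokesRegularity.NavierStokesRegularity.Theorems.StrainDoors

end
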